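import Summits.KontsevichZagierPeriods.KontsevichZagierPeriods.Theses.FurushoPentagon
import Literature.NumberTheory.Transcendental.KZLogCalculusProofs

/-!
# `PentagonInKZ` (stmt-KontsevichZagierPeriods-11348), line `logfree-gauge-corner-flatness`:
# stub `stub_chartB` — the Möbius change of variables (analytic half)

Support file for the stub `stub_chartB` (the chart identity `B(X,W) = A(X,-X-W) e^{λX}` between
the two half-edge transports of the pentagon cell). Here: the CONVERGENT-WORD identity behind
it, as a statement about classes in `KZ.FormalRep ⧸ KZ.relations` (registered sub-stub
`chartB_core`).

For a word `f` over the two letters `0 ↦ ds/s`, `1 ↦ ds/(s+1)` of the path family `10`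
(poles `0, -1`, bound `1`) NOT ending in the letter `0`, the Möbius chart `s = τ/(1-τ)`
(coordinatewise on the ordered simplex `{½ > τ₀ > ⋯ > τ_{n-1} > 0} → {1 > s₀ > ⋯ > 0}`, order
preserving, diagonal Jacobian `∏ 1/(1-τᵢ)²`, `ℚ`-semialgebraic, injective) is ONE
`KZ.changeOfVariablesRel` move; since `ds/s = dτ/τ - dτ/(τ-1)` and `ds/(s+1) = -dτ/(τ-1)`, the
pulled-back integrand is the signed sum, over the letter substitution `0 ↦ (0) - (1)`,
`1 ↦ -(1)` (integer matrix `cz(u,f) = [u=1](-1) + [u=0][f=0]`, the tree's `NCSeries.mXZ`), of the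
integrands of the path family `5` (poles `0, 1`, bound `½`), all on words ending in the letter `1`
(signed iterated integrand additivity). This file declares no definitions.

References: M. Kontsevich, D. Zagier, *Periods* (2001), §1.2 rules (1b), (2).
-/

noncomputable section

open Set MeasureTheory MvPolynomial
open Literature.NumberTheory.Transcendental
open Literature.ModelTheory.ExponentialFields (IsSemialgebraic)

namespace Summit.KontsevichZagierPeriods.FurushoPentagon.PentagonInKZ

namespace ChartB

/-! ### The Möbius chart `s = τ/(1-τ)` -/

/-- `d/dt (t/(1-t)) = 1/(1-t)²` away from `t = 1`. [folklore] -/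
theorem hasDerivAt_div_one_sub {t : ℝ} (ht : t ≠ 1) :
    HasDerivAt (fun s : ℝ => s / (1 - s)) (1 / (1 - t) ^ 2) t := by
  have h1 : (1 : ℝ) - t ≠ 0 := sub_ne_zero.mpr (Ne.symm ht)
  have h := (hasDerivAt_id' t).fun_div ((hasDerivAt_const t (1 : ℝ)).fun_sub (hasDerivAt_id' t)) h1
  refine h.congr_deriv ?_
  rw [div_eq_div_iff (pow_ne_zero 2 h1) (pow_ne_zero 2 h1)]
  ring

/-- The Möbius chart is differentiable away from the hyperplanes `τᵢ = 1`, with the diagonal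
derivative `(vᵢ/(1-τᵢ)²)ᵢ`. [folklore] -/
theorem hasFDerivAt_moeb {n : ℕ} (τ : Fin n → ℝ) (hτ : ∀ i, τ i ≠ 1) :
    HasFDerivAt (fun (τ : Fin n → ℝ) (i : Fin n) => τ i / (1 - τ i)) (ContinuousLinearMap.pi fun i => (1 / (1 - τ i) ^ 2) •
    ContinuousLinearMap.proj (R := ℝ) (φ := fun _ : Fin n => ℝ) i) τ := by
  refine hasFDerivAt_pi.mpr fun i => ?_
  have h := HasDerivAt.comp_hasFDerivAt (h₂ := fun s : ℝ => s / (1 - s))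
    (f := fun f : Fin n → ℝ => f i) τ (hasDerivAt_div_one_sub (hτ i))
    (hasFDerivAt_apply (𝕜 := ℝ) i τ)
  exact h

/-- The Jacobian determinant of the Möbius chart is `∏ᵢ 1/(1-τᵢ)²`. [folklore] -/
theorem det_moebD {n : ℕ} (τ : Fin n → ℝ) : ((ContinuousLinearMap.pi fun i => (1 / (1 - τ i) ^ 2) •
    ContinuousLinearMap.proj (R := ℝ) (φ := fun _ : Fin n => ℝ) i)).det = ∏ i, 1 / (1 - τ i) ^ 2 := by
  have hM : LinearMap.toMatrix' (((ContinuousLinearMap.pi fun i => (1 / (1 - τ i) ^ 2) •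
    ContinuousLinearMap.proj (R := ℝ) (φ := fun _ : Fin n => ℝ) i) : (Fin n → ℝ) →L[ℝ] (Fin n → ℝ)) :
      (Fin n → ℝ) →ₗ[ℝ] (Fin n → ℝ)) = Matrix.diagonal fun i => 1 / (1 - τ i) ^ 2 := by
    ext i j
    rw [LinearMap.toMatrix'_apply]
    simp [Matrix.diagonal_apply, Pi.single_apply]
  rw [ContinuousLinearMap.det, ← LinearMap.det_toMatrix', hM, Matrix.det_diagonal]

/-- `t ↦ t/(1-t)` is strictly increasing below `t = 1`. [folklore] -/
theorem div_one_sub_lt {a b : ℝ} (hab : a < b) (hb : b < 1) : a / (1 - a) < b / (1 - b) := by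
  rw [div_lt_div_iff₀ (by linarith) (by linarith)]
  nlinarith

/-- The Möbius chart maps the simplex of size `½` into the simplex of size `1`. [folklore] -/
theorem moeb_mem {n : ℕ} {τ : Fin n → ℝ} (hτ : τ ∈ {t : Fin n → ℝ | (∀ i, 0 < t i ∧ t i < 1 / 2) ∧ StrictAnti t}) :
    (fun i => τ i / (1 - τ i)) ∈ {t : Fin n → ℝ | (∀ i, 0 < t i ∧ t i < 1) ∧ StrictAnti t} := by
  obtain ⟨hb, ha⟩ := hτ
  refine ⟨fun i => ⟨div_pos (hb i).1 (by linarith [(hb i).2]), ?_⟩, fun i j hij => ?_⟩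
  · rw [div_lt_one (by linarith [(hb i).2])]
    linarith [(hb i).2]
  · exact div_one_sub_lt (ha hij) (by linarith [(hb i).2])

/-- The Möbius chart is injective on the simplex of size `½`. [folklore] -/
theorem injOn_moeb (n : ℕ) : InjOn (fun (τ : Fin n → ℝ) (i : Fin n) => τ i / (1 - τ i)) {t : Fin n → ℝ | (∀ i, 0 < t i ∧ t i < 1 / 2) ∧ StrictAnti t} := by
  intro τ hτ τ' hτ' h
  funext i
  have hi : τ i / (1 - τ i) = τ' i / (1 - τ' i) := congrFun h i
  have h1 : (1 : ℝ) - τ i ≠ 0 := by linarith [(hτ.1 i).2]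
  have h2 : (1 : ℝ) - τ' i ≠ 0 := by linarith [(hτ'.1 i).2]
  rw [div_eq_div_iff h1 h2] at hi
  nlinarith

/-- The Möbius chart maps the simplex of size `½` ONTO the simplex of size `1` (inverse
`s ↦ s/(1+s)`). [folklore] -/
theorem image_moeb (n : ℕ) : (fun (τ : Fin n → ℝ) (i : Fin n) => τ i / (1 - τ i)) '' {t : Fin n → ℝ | (∀ i, 0 < t i ∧ t i < 1 / 2) ∧ StrictAnti t} = {t : Fin n → ℝ | (∀ i, 0 < t i ∧ t i < 1) ∧ StrictAnti t} := by
  refine Subset.antisymm (fun s ⟨τ, hτ, hs⟩ => hs ▸ moeb_mem hτ) fun s hs => ?_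
  obtain ⟨hb, ha⟩ := hs
  refine ⟨fun i => s i / (1 + s i), ⟨fun i => ⟨div_pos (hb i).1 (by linarith [(hb i).1]), ?_⟩,
    fun i j hij => ?_⟩, ?_⟩
  · rw [div_lt_iff₀ (by linarith [(hb i).1])]
    linarith [(hb i).2]
  · have := ha hij
    rw [div_lt_div_iff₀ (by linarith [(hb j).1]) (by linarith [(hb i).1])]
    nlinarith
  · funext i
    have h1 : (1 : ℝ) + s i ≠ 0 := by linarith [(hb i).1]
    field_simp
    ring

/-- The Möbius chart is a `ℚ`-semialgebraic map on every `ℚ`-semialgebraic set missing the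
hyperplanes `τᵢ = 1` (coordinatewise a quotient of polynomials). [cite: BochnakCosteRoy1998, §2.2] -/
theorem isSemialgebraicMapOn_moeb {n : ℕ} {σ : Set (Fin n → ℝ)} (hσ : IsSemialgebraic ℚ σ)
    (h1 : ∀ τ ∈ σ, ∀ i, τ i ≠ 1) : IsSemialgebraicMapOn ℚ σ (fun (τ : Fin n → ℝ) (i : Fin n) => τ i / (1 - τ i)) := by
  refine IsSemialgebraicMapOn.of_forall hσ fun j => ?_
  refine (isSemialgebraicFunOn_aeval_div_aeval hσ (X j) (1 - X j) fun τ hτ => ?_).congr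
    fun τ _ => ?_
  · simpa [sub_eq_zero] using (h1 τ hτ j).symm
  · simp

/-- The Jacobian `|∏ᵢ 1/(1-τᵢ)²|` of the Möbius chart is a `ℚ`-semialgebraic function on every
`ℚ`-semialgebraic set missing the hyperplanes `τᵢ = 1`. [cite: BochnakCosteRoy1998, §2.2] -/
theorem isSemialgebraicFunOn_abs_det_moebD {n : ℕ} {σ : Set (Fin n → ℝ)}
    (hσ : IsSemialgebraic ℚ σ) (h1 : ∀ τ ∈ σ, ∀ i, τ i ≠ 1) :
    IsSemialgebraicFunOn ℚ σ (fun τ => |((ContinuousLinearMap.pi fun i => (1 / (1 - τ i) ^ 2) •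
    ContinuousLinearMap.proj (R := ℝ) (φ := fun _ : Fin n => ℝ) i)).det|) := by
  refine IsSemialgebraicFunOn.abs ?_
  refine (isSemialgebraicFunOn_aeval_div_aeval hσ 1 (∏ i, (1 - X i) ^ 2) fun τ hτ => ?_).congr
    fun τ _ => ?_
  · rw [map_prod]
    exact Finset.prod_ne_zero_iff.mpr fun i _ => by
      simpa [sub_eq_zero] using (h1 τ hτ i).symm
  · rw [det_moebD]
    simp [map_prod]

/-- **Transport along the Möbius chart** (one KZ change-of-variables move): every representation
`r'` on the simplex `{1 > s₀ > ⋯ > s_{n-1} > 0}` pulls back to a representation `r` on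
`{½ > τ₀ > ⋯ > τ_{n-1} > 0}` with integrand `(r'.integrand ∘ moeb) · |Jac|`, and `[r] - [r']` is a
relation. [cite: KontsevichZagier2001, §1.2 rule (2)] -/
theorem moeb_transport {n : ℕ} (r' : KZ.IntegralRep n) (hr' : r'.domain = {t : Fin n → ℝ | (∀ i, 0 < t i ∧ t i < 1) ∧ StrictAnti t})
    (hD : IsSemialgebraic ℚ {t : Fin n → ℝ | (∀ i, 0 < t i ∧ t i < 1 / 2) ∧ StrictAnti t}) :
    ∃ r : KZ.IntegralRep n, r.domain = {t : Fin n → ℝ | (∀ i, 0 < t i ∧ t i < 1 / 2) ∧ StrictAnti t} ∧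
      (r.integrand = fun τ => r'.integrand (fun i => τ i / (1 - τ i)) * |((ContinuousLinearMap.pi fun i => (1 / (1 - τ i) ^ 2) •
    ContinuousLinearMap.proj (R := ℝ) (φ := fun _ : Fin n => ℝ) i)).det|) ∧
      KZ.of r - KZ.of r' ∈ KZ.relations := by
  have hne1 : ∀ τ ∈ {t : Fin n → ℝ | (∀ i, 0 < t i ∧ t i < 1 / 2) ∧ StrictAnti t}, ∀ i, τ i ≠ 1 := fun τ hτ i => by
    have := (hτ.1 i).2; intro h; rw [h] at this; norm_num at this
  have hderiv : ∀ τ ∈ {t : Fin n → ℝ | (∀ i, 0 < t i ∧ t i < 1 / 2) ∧ StrictAnti t}, HasFDerivWithinAt (fun (τ : Fin n → ℝ) (i : Fin n) => τ i / (1 - τ i)) (ContinuousLinearMap.pi fun i => (1 / (1 - τ i) ^ 2) •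
    ContinuousLinearMap.proj (R := ℝ) (φ := fun _ : Fin n => ℝ) i) {t : Fin n → ℝ | (∀ i, 0 < t i ∧ t i < 1 / 2) ∧ StrictAnti t} τ :=
    fun τ hτ => (hasFDerivAt_moeb τ (hne1 τ hτ)).hasFDerivWithinAt
  have hCsa : IsSemialgebraicMapOn ℚ {t : Fin n → ℝ | (∀ i, 0 < t i ∧ t i < 1 / 2) ∧ StrictAnti t} (fun (τ : Fin n → ℝ) (i : Fin n) => τ i / (1 - τ i)) := isSemialgebraicMapOn_moeb hD hne1
  have hDm : MeasurableSet {t : Fin n → ℝ | (∀ i, 0 < t i ∧ t i < 1 / 2) ∧ StrictAnti t} :=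
    Literature.ModelTheory.ExponentialFields.IsSemialgebraic.measurableSet_holds hD
  have hJsa := isSemialgebraicFunOn_abs_det_moebD hD hne1
  have hmaps : MapsTo (fun (τ : Fin n → ℝ) (i : Fin n) => τ i / (1 - τ i)) {t : Fin n → ℝ | (∀ i, 0 < t i ∧ t i < 1 / 2) ∧ StrictAnti t} r'.domain := fun τ hτ => hr' ▸ moeb_mem hτ
  set g : (Fin n → ℝ) → ℝ := fun τ => r'.integrand (fun i => τ i / (1 - τ i)) * |((ContinuousLinearMap.pi fun i => (1 / (1 - τ i) ^ 2) •
    ContinuousLinearMap.proj (R := ℝ) (φ := fun _ : Fin n => ℝ) i)).det|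
    with hg
  have hgsa : IsSemialgebraicFunOn ℚ {t : Fin n → ℝ | (∀ i, 0 < t i ∧ t i < 1 / 2) ∧ StrictAnti t} g :=
    IsSemialgebraicFunOn.mul_holds (IsSemialgebraicFunOn.comp_isSemialgebraicMapOn_holds
      r'.isSemialgebraicFunOn_integrand hCsa hmaps) hJsa
  have hgi : IntegrableOn g {t : Fin n → ℝ | (∀ i, 0 < t i ∧ t i < 1 / 2) ∧ StrictAnti t} := by
    have h1 : IntegrableOn r'.integrand ((fun (τ : Fin n → ℝ) (i : Fin n) => τ i / (1 - τ i)) '' {t : Fin n → ℝ | (∀ i, 0 < t i ∧ t i < 1 / 2) ∧ StrictAnti t}) := by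
      rw [image_moeb, ← hr']; exact r'.integrableOn
    have h2 := (integrableOn_image_iff_integrableOn_abs_det_fderiv_smul volume hDm
      hderiv (injOn_moeb n) r'.integrand).mp h1
    refine h2.congr_fun (fun τ _ => ?_) hDm
    show |((ContinuousLinearMap.pi fun i => (1 / (1 - τ i) ^ 2) •
    ContinuousLinearMap.proj (R := ℝ) (φ := fun _ : Fin n => ℝ) i)).det| • r'.integrand (fun i => τ i / (1 - τ i)) =
      r'.integrand (fun i => τ i / (1 - τ i)) * |((ContinuousLinearMap.pi fun i => (1 / (1 - τ i) ^ 2) •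
    ContinuousLinearMap.proj (R := ℝ) (φ := fun _ : Fin n => ℝ) i)).det|
    rw [smul_eq_mul, mul_comm]
  refine ⟨⟨{t : Fin n → ℝ | (∀ i, 0 < t i ∧ t i < 1 / 2) ∧ StrictAnti t}, g, hD, hgsa, hgi⟩, rfl, rfl, ?_⟩
  exact KZ.changeOfVariablesRel_subset_relations ⟨n, _, r', (fun (τ : Fin n → ℝ) (i : Fin n) => τ i / (1 - τ i)), fun τ => (ContinuousLinearMap.pi fun i => (1 / (1 - τ i) ^ 2) •
    ContinuousLinearMap.proj (R := ℝ) (φ := fun _ : Fin n => ℝ) i), hCsa,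
    hderiv, injOn_moeb n, by rw [hr', image_moeb], fun τ _ => rfl, rfl⟩

/-! ### The letter substitution and the pulled-back integrand -/

/-- **One coordinate of the pull-back**: `(1/(s - p₁₀(f))) ds = Σ_u cz(u,f) dτ/(τ - p₅(u))`
under `s = τ/(1-τ)`, i.e. `ds/s = dτ/τ - dτ/(τ-1)` and `ds/(s+1) = -dτ/(τ-1)`. [folklore] -/
theorem one_div_moeb_mul (f : Bool) {t : ℝ} (h0 : t ≠ 0) (h1 : t ≠ 1) :
    1 / (t / (1 - t) - (if f then -1 else 0 : ℝ)) * (1 / (1 - t) ^ 2) =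
      ∑ u : Bool, ((if u then -1 else if f then 0 else 1 : ℤ) : ℝ) * (1 / (t - (if u then 1 else 0 : ℝ))) := by
  have h1' : (1 : ℝ) - t ≠ 0 := sub_ne_zero.mpr (Ne.symm h1)
  have h1'' : t - 1 ≠ 0 := sub_ne_zero.mpr h1
  rw [Fintype.sum_bool]
  cases f
  · simp only [Bool.false_eq_true, if_false, if_true, sub_zero]
    push_cast
    field_simp
    ring
  · simp only [if_true, sub_neg_eq_add]
    push_cast
    field_simp
    ring

/-- **The pulled-back integrand** of the word `f` of the family `10` along the Möbius chart,
Jacobian included, is the signed sum over the letter substitution of the integrands of the family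
`5`: `∏ᵢ (1/(sᵢ - p₁₀ fᵢ)) · |Jac| = Σ_u (∏ᵢ cz(uᵢ,fᵢ)) ∏ᵢ 1/(τᵢ - p₅ uᵢ)` on the simplex of
size `½`. [folklore] -/
theorem pullback_integrand {n : ℕ} (f : Fin n → Bool) {τ : Fin n → ℝ} (hτ : τ ∈ {t : Fin n → ℝ | (∀ i, 0 < t i ∧ t i < 1 / 2) ∧ StrictAnti t}) :
    (∏ i, 1 / (τ i / (1 - τ i) - (if f i then -1 else 0 : ℝ))) * |((ContinuousLinearMap.pi fun i => (1 / (1 - τ i) ^ 2) •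
    ContinuousLinearMap.proj (R := ℝ) (φ := fun _ : Fin n => ℝ) i)).det| =
      ∑ u : Fin n → Bool, ((∏ i, (if u i then -1 else if f i then 0 else 1 : ℤ) : ℤ) : ℝ) * ∏ i, 1 / (τ i - (if u i then 1 else 0 : ℝ)) := by
  have h0 : ∀ i, τ i ≠ 0 := fun i => (hτ.1 i).1.ne'
  have h1 : ∀ i, τ i ≠ 1 := fun i => by
    have := (hτ.1 i).2; intro h; rw [h] at this; norm_num at this
  rw [det_moebD, abs_of_nonneg (Finset.prod_nonneg fun i _ => by positivity),
    ← Finset.prod_mul_distrib]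
  rw [Finset.prod_congr rfl fun i _ => one_div_moeb_mul (f i) (h0 i) (h1 i), Fintype.prod_sum]
  refine Finset.sum_congr rfl fun u _ => ?_
  rw [Finset.prod_mul_distrib, Int.cast_prod]

/-! ### Signed iterated integrand additivity -/

/-- A finite product of integers in `{0, 1, -1}` lies in `{0, 1, -1}`. [folklore] -/
theorem prod_trichotomy {ι : Type*} (s : Finset ι) (a : ι → ℤ)
    (ha : ∀ i, a i = 0 ∨ a i = 1 ∨ a i = -1) :
    (∏ i ∈ s, a i) = 0 ∨ (∏ i ∈ s, a i) = 1 ∨ (∏ i ∈ s, a i) = -1 := by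
  classical
  induction s using Finset.induction_on with
  | empty => simp
  | insert b s hb ih =>
    rw [Finset.prod_insert hb]
    rcases ha b with h | h | h <;> rcases ih with h' | h' | h' <;> simp [h, h']

/-- **Splitting an integrand into a signed sum** (iterated integrand additivity with coefficients
`0, ±1`): if `R.integrand = Σᵢ cᵢ gᵢ` on the domain of `R`, each `gᵢ` is `ℚ`-semialgebraic on it,
`cᵢ gᵢ` is integrable on it, and for `cᵢ ≠ 0` the representation `Rᵢ` has the same domain and
integrand `gᵢ` on it, then `[R] - Σᵢ cᵢ [Rᵢ]` is a relation. [cite: KontsevichZagier2001, §1.2 rule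
(1)] -/
theorem of_sub_sum_zsmul_mem_relations {N : ℕ} {ι : Type*} [Fintype ι] (R : KZ.IntegralRep N)
    (c : ι → ℤ) (hc : ∀ i, c i = 0 ∨ c i = 1 ∨ c i = -1) (g : ι → (Fin N → ℝ) → ℝ)
    (hg : ∀ i, IsSemialgebraicFunOn ℚ R.domain (g i))
    (hgi : ∀ i, IntegrableOn (fun x => (c i : ℝ) * g i x) R.domain)
    (Rs : ι → KZ.IntegralRep N)
    (hRs : ∀ i, c i ≠ 0 → (Rs i).domain = R.domain ∧ EqOn (Rs i).integrand (g i) R.domain)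
    (h : EqOn R.integrand (fun x => ∑ i, (c i : ℝ) * g i x) R.domain) :
    KZ.of R - ∑ i, c i • KZ.of (Rs i) ∈ KZ.relations := by
  classical
  -- the signed pieces `[σ, cᵢ gᵢ]`
  let T : ι → KZ.IntegralRep N := fun i =>
    { domain := R.domain
      integrand := fun x => (c i : ℝ) * g i x
      isSemialgebraic_domain := R.isSemialgebraic_domain
      isSemialgebraicFunOn_integrand :=
        (IsSemialgebraicFunOn.mul_holds (isSemialgebraicFunOn_ratCast R.isSemialgebraic_domain
          (c i : ℚ)) (hg i)).congr fun x _ => by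
            show ((c i : ℚ) : ℝ) * g i x = (c i : ℝ) * g i x
            rw [Rat.cast_intCast]
      integrableOn := hgi i }
  -- unsigned additivity over `Fin k`
  obtain ⟨Z, hZd, hZi⟩ := KZ.exists_zeroRep R.isSemialgebraic_domain
  set e := Fintype.equivFin ι with he
  have h1 : KZ.of R - KZ.of Z - ∑ j : Fin (Fintype.card ι), KZ.of (T (e.symm j)) ∈
      KZ.relations := by
    refine KZ.of_sub_of_sub_sum_mem_relations _ R Z (fun j => T (e.symm j)) hZd (fun _ => rfl)
      fun x hx => ?_
    show R.integrand x = Z.integrand x + ∑ j, (T (e.symm j)).integrand x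
    rw [h hx, hZi]
    simp only [Pi.zero_apply, zero_add]
    exact (e.symm.sum_comp (fun i => (c i : ℝ) * g i x)).symm
  have h2 : KZ.of Z ∈ KZ.relations := KZ.of_mem_relations_of_eqOn_zero Z (by simp [hZi, EqOn])
  have h3 : ∑ j : Fin (Fintype.card ι), KZ.of (T (e.symm j)) = ∑ i, KZ.of (T i) :=
    e.symm.sum_comp (fun i => KZ.of (T i))
  -- termwise comparison `[T i] - cᵢ [Rs i] ∈ relations`
  have h4 : ∀ i, KZ.of (T i) - c i • KZ.of (Rs i) ∈ KZ.relations := by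
    intro i
    rcases hc i with h0 | h0 | h0
    · rw [h0, zero_smul, sub_zero]
      exact KZ.of_mem_relations_of_eqOn_zero _ fun x _ => by simp [T, h0]
    · rw [h0, one_smul]
      obtain ⟨hd, hi⟩ := hRs i (by rw [h0]; exact one_ne_zero)
      exact KZ.of_sub_of_mem_relations_of_eqOn hd fun x hx => by
        show (c i : ℝ) * g i x = (Rs i).integrand x
        rw [h0, hi hx]; simp
    · rw [h0, neg_smul, one_smul, sub_neg_eq_add]
      obtain ⟨hd, hi⟩ := hRs i (by rw [h0]; norm_num)
      exact KZ.of_add_of_mem_relations_of_eqOn_neg hd fun x hx => by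
        show (Rs i).integrand x = -((c i : ℝ) * g i x)
        rw [h0, hi hx]; simp
  have : KZ.of R - ∑ i, c i • KZ.of (Rs i) =
      (KZ.of R - KZ.of Z - ∑ j : Fin (Fintype.card ι), KZ.of (T (e.symm j))) + KZ.of Z +
        ∑ i, (KZ.of (T i) - c i • KZ.of (Rs i)) := by
    rw [h3, Finset.sum_sub_distrib]; abel
  rw [this]
  exact KZ.relations.add_mem (KZ.relations.add_mem h1 h2) (sum_mem fun i _ => h4 i)

/-! ### The convergent-word identity (cast-free core) -/

/-- The integrand `∏ᵢ 1/(τᵢ - p₅ uᵢ)` of a two-letter word of the family `5` is `ℚ`-semialgebraic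
on the simplex of size `½` (a quotient of polynomials with non-vanishing denominator).
[cite: BochnakCosteRoy1998, §2.2] -/
theorem isSemialgebraicFunOn_prod_p5 {n : ℕ} (u : Fin n → Bool)
    (hD : IsSemialgebraic ℚ {t : Fin n → ℝ | (∀ i, 0 < t i ∧ t i < 1 / 2) ∧ StrictAnti t}) :
    IsSemialgebraicFunOn ℚ {t : Fin n → ℝ | (∀ i, 0 < t i ∧ t i < 1 / 2) ∧ StrictAnti t} (fun τ => ∏ i, 1 / (τ i - (if u i then 1 else 0 : ℝ))) := by
  refine (isSemialgebraicFunOn_aeval_div_aeval hD 1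
    (∏ i, (X i - (if u i then 1 else 0))) fun τ hτ => ?_).congr fun τ hτ => ?_
  · rw [map_prod]
    refine Finset.prod_ne_zero_iff.mpr fun i _ => ?_
    have h1 := (hτ.1 i).1; have h2 := (hτ.1 i).2
    cases u i <;> simp <;> linarith
  · simp only [map_one, map_prod, one_div, ← Finset.prod_inv_distrib]
    refine Finset.prod_congr rfl fun i _ => ?_
    cases u i <;> simp

end ChartB

/-- **Sub-stub `chartB_core` of `stub_chartB`: the convergent-word identity of the chart
`s = τ/(1-τ)`** (cast-free core). For a two-letter word `f` (`false` = the letter `ds/s`,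
`true` = `ds/(s+1)`) of the path family with poles `0, -1` on `{1 > s₀ > ⋯ > s_{n-1} > 0}`, a
representation `r₁₀` of it, and representations `r₅ u` of the words `u` (`false` = `dτ/τ`,
`true` = `dτ/(τ-1)`) on `{½ > τ₀ > ⋯ > 0}` for those `u` with non-zero coefficient
`∏ᵢ cz(uᵢ,fᵢ)` (`cz(u,f) = [u = 1](-1) + [u = 0][f = 0]`, the matrix of the letter substitution
dual to `ds/s = dτ/τ - dτ/(τ-1)`, `ds/(s+1) = -dτ/(τ-1)`):
`[r₁₀] - Σ_u (∏ᵢ cz(uᵢ,fᵢ)) [r₅ u] ∈ KZ.relations` — one change of variables along the Möbius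
chart, then signed integrand additivity. [cite: KontsevichZagier2001, §1.2 rules (1), (2)] -/
theorem chartB_core :
    ∀ (n : ℕ) (f : Fin n → Bool) (r10 : KZ.IntegralRep n), r10.domain = {t : Fin n → ℝ | (∀ i, 0 < t i ∧ t i < 1) ∧ StrictAnti t} → Set.EqOn r10.integrand (fun s => ∏ i, 1 / (s i - (if f i then (-1 : ℝ) else 0))) {t : Fin n → ℝ | (∀ i, 0 < t i ∧ t i < 1) ∧ StrictAnti t} → ∀ (r5 : (Fin n → Bool) → KZ.IntegralRep n), (∀ u : Fin n → Bool, (∏ i, (if u i then (-1 : ℤ) else if f i then 0 else 1)) ≠ 0 → (r5 u).domain = {t : Fin n → ℝ | (∀ i, 0 < t i ∧ t i < 1 / 2) ∧ StrictAnti t} ∧ Set.EqOn (r5 u).integrand (fun τ => ∏ i, 1 / (τ i - (if u i then (1 : ℝ) else 0))) {t : Fin n → ℝ | (∀ i, 0 < t i ∧ t i < 1 / 2) ∧ StrictAnti t}) → KZ.of r10 - ∑ u : Fin n → Bool, (∏ i, (if u i then (-1 : ℤ) else if f i then 0 else 1)) • KZ.of (r5 u) ∈ KZ.relations := by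
  intro n f r10 h10d h10i r5 h5
  -- the domain `Δ_½` is semialgebraic: it is the domain of `r5 (all true)`
  have hc1 : (∏ i, (if true then -1 else if f i then 0 else 1 : ℤ)) ≠ 0 := Finset.prod_ne_zero_iff.mpr fun i _ => by simp
  have hD : IsSemialgebraic ℚ {t : Fin n → ℝ | (∀ i, 0 < t i ∧ t i < 1 / 2) ∧ StrictAnti t} := by
    rw [← (h5 (fun _ => true) hc1).1]; exact (r5 _).isSemialgebraic_domain
  -- one change of variables
  obtain ⟨J, hJd, hJi, hJ⟩ := ChartB.moeb_transport r10 h10d hD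
  -- the pulled-back integrand is the signed sum
  have hJsum : EqOn J.integrand
      (fun τ => ∑ u : Fin n → Bool, ((∏ i, (if u i then -1 else if f i then 0 else 1 : ℤ) : ℤ) : ℝ) * ∏ i, 1 / (τ i - (if u i then 1 else 0 : ℝ)))
      J.domain := by
    intro τ hτ
    rw [hJd] at hτ
    rw [hJi]
    show r10.integrand (fun i => τ i / (1 - τ i)) * |((ContinuousLinearMap.pi fun i => (1 / (1 - τ i) ^ 2) •
    ContinuousLinearMap.proj (R := ℝ) (φ := fun _ : Fin n => ℝ) i)).det| =
      ∑ u : Fin n → Bool, ((∏ i, (if u i then -1 else if f i then 0 else 1 : ℤ) : ℤ) : ℝ) * ∏ i, 1 / (τ i - (if u i then 1 else 0 : ℝ))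
    rw [h10i (ChartB.moeb_mem hτ), ← ChartB.pullback_integrand f hτ]
  -- signed additivity
  have hcz : ∀ u : Fin n → Bool, (∏ i, (if u i then -1 else if f i then 0 else 1 : ℤ)) = 0 ∨ (∏ i, (if u i then -1 else if f i then 0 else 1 : ℤ)) = 1 ∨
      (∏ i, (if u i then -1 else if f i then 0 else 1 : ℤ)) = -1 := fun u =>
    ChartB.prod_trichotomy _ _ fun i => by split_ifs <;> simp
  have hgi : ∀ u : Fin n → Bool, IntegrableOn
      (fun τ => ((∏ i, (if u i then -1 else if f i then 0 else 1 : ℤ) : ℤ) : ℝ) * ∏ i, 1 / (τ i - (if u i then 1 else 0 : ℝ))) J.domain := by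
    intro u
    by_cases hu : (∏ i, (if u i then -1 else if f i then 0 else 1 : ℤ)) = 0
    · simp only [hu, Int.cast_zero, zero_mul]; exact integrableOn_zero
    · obtain ⟨hd, hi⟩ := h5 u hu
      have hm : MeasurableSet (r5 u).domain := KZ.IntegralRep.measurableSet_domain_holds (r5 u)
      have hi' : EqOn (r5 u).integrand (fun τ => ∏ i, 1 / (τ i - (if u i then 1 else 0 : ℝ))) (r5 u).domain := by
        rw [hd]; exact hi
      have := ((r5 u).integrableOn.congr_fun hi' hm).const_mul (((∏ i, (if u i then -1 else if f i then 0 else 1 : ℤ) : ℤ) : ℝ))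
      rwa [hd, ← hJd] at this
  have hsa : ∀ u : Fin n → Bool,
      IsSemialgebraicFunOn ℚ J.domain (fun τ => ∏ i, 1 / (τ i - (if u i then 1 else 0 : ℝ))) := fun u => by
    rw [hJd]; exact ChartB.isSemialgebraicFunOn_prod_p5 u hD
  have h5' : ∀ u : Fin n → Bool, (∏ i, (if u i then -1 else if f i then 0 else 1 : ℤ)) ≠ 0 → (r5 u).domain = J.domain ∧
      EqOn (r5 u).integrand (fun τ => ∏ i, 1 / (τ i - (if u i then 1 else 0 : ℝ))) J.domain := by
    intro u hu; rw [hJd]; exact h5 u hu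
  have hadd : KZ.of J - ∑ u, (∏ i, (if u i then -1 else if f i then 0 else 1 : ℤ)) • KZ.of (r5 u) ∈ KZ.relations :=
    ChartB.of_sub_sum_zsmul_mem_relations (ι := Fin n → Bool) J (fun u => ∏ i, (if u i then -1 else if f i then 0 else 1 : ℤ)) hcz
      (fun u τ => ∏ i, 1 / (τ i - (if u i then 1 else 0 : ℝ))) hsa hgi r5 h5' hJsum
  have : KZ.of r10 - ∑ u, (∏ i, (if u i then -1 else if f i then 0 else 1 : ℤ)) • KZ.of (r5 u) =
      (KZ.of J - ∑ u, (∏ i, (if u i then -1 else if f i then 0 else 1 : ℤ)) • KZ.of (r5 u)) - (KZ.of J - KZ.of r10) := by abel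
  rw [this]
  exact KZ.relations.sub_mem hadd hJ

end Summit.KontsevichZagierPeriods.FurushoPentagon.PentagonInKZ
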